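import Summits.QuantumFields.YangMills.Theses.SqueezedSkewness
import Summits.QuantumFields.YangMills.Theorems.SqueezedSkewnessAntipodalMarkovGlue
import Summits.QuantumFields.YangMills.Theorems.BalabanLadderNTBoundaryLawCore
import Summits.QuantumFields.YangMills.Theorems.BalabanLadderNTReferenceTransferCumulant
import HarnessLib

/-!
# Route `SqueezedSkewness`, crux `AntipodalMirrorCeiling` (stmt-QuantumFields-23202): the registered stubs
# `stub_markovGlue` and `stub_twinOfMixing` BY NAME AND SIGNATURE

v2 birth skeleton `Cruxes/NT/Lines/antipodal_markov_birth.lean` (planner ym-idea-6 g11; LINE «Markov ceiling», bears_on R2a /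
stmt-QuantumFields-19353 via the route's `closes`).  The name-keyed statements are reproduced VERBATIM (own namespace); proved:

* `stub_markovGlue` (= the glue item 23391) — the landed `AntipodalMarkovGlue.antipodalMarkovGlue_proof`;
* `stub_twinOfMixing : AntipodalMixing → BoundaryResponseMixing` — the filed rate-free mixing item implies the NARROW twin
  (idea-crit-9 #53 P2): translate the straddling cube spatially to `(c 0, 0⃗)` (`mirror_cov_kerE_shift`: `kerE_dens_configShift`,
  `cfgReflect_configShift`, translation invariance of the torus state `torusE_comp_configShift'`), renormalise the response affinely
  (`mirror_cov_kerE_eq_sq_mul`, from `AntipodalMarkovGlue.cov_affine`), transport to the `Fin`-torus (`covF_toFin_reflF` of the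
  reflected dictionary) and apply `AntipodalMixing` at radius `ℓ + 1`, `b' = b + 1` — the translated response reads only links within
  torus sup-distance `b + 1` of `x₀ = (0⃗, ⌊T/4⌋)` (`torusLift_configPerm_symm_apply`, `finLink_fst`, `min_val_intCast_le`,
  `min_natAbs_val_intCast_le`); degenerate `s ≤ 0`: the response is constant and the covariance vanishes.

With the width seat's landed `stub_markovGlueNarrow` (`…AntipodalMarkovGlueNarrow`, ym-line-sfw-p2-w5) the crux reduces BY NAME to
`stub_floorUnitFBL6 ∧ stub_antipodalMixing` or to `stub_floorUnitFBL6 ∧ stub_boundaryResponseMixing`, the two mixing inputs being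
comparable by `stub_twinOfMixing`.  Fleet lead `ym-spine-19353-p1` g19.  HONEST FRAMING: `FloorUnitFBL6`, `AntipodalMixing`,
`BoundaryResponseMixing` are NOT proved; no summit, rung, crux `NT` or mass gap follows. [folklore]
-/

set_option autoImplicit false

noncomputable section

namespace Summit.QuantumFields.YangMills.Theorems.AntipodalMarkovTwin

open MeasureTheory Filter Topology
open Literature.MathematicalPhysics.QuantumFieldTheory Literature.MathematicalPhysics.QuantumLattice
open Literature.Probability.LatticeModels (Torus.proj Torus.proj_apply)
open Summit.QuantumFields.YangMills.Cruxes.OSLegsFromFemtoAndGap.DlrCollarTransfer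
open Summit.QuantumFields.YangMills.Cruxes.OSLegsFromFemtoAndGap.DlrCollarTransfer.StubLower
  (mem_cubeSites_iff isCylinder_dens exists_abs_dens_le dens_supp_window le_depth_cube)
open Summit.QuantumFields.YangMills.Theorems.OSLegsFromFemtoAndGap.StubLower (integrable_of_continuous_compact)
open Summit.QuantumFields.YangMills.Cruxes.NT.Reference
  (continuous_kerE eventually_le_of_tendsto div_pow_depth_le dens_supp_window_of_depth_pos)
open Summit.QuantumFields.YangMills.Cruxes.NT.BoundaryLaw (abs_kerE_le kerE_dens_configShift)
open Summit.QuantumFields.YangMills.Cruxes.OSLegsAtWeakCouplingC.InheritedAmplitudeGates.StubInherit (window_of_depth_pos)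
open Summit.QuantumFields.YangMills.Cruxes.NT.MarkovMirror
open Summit.QuantumFields.YangMills.Theorems.ThermalDescentTorusDictionary
open Summit.QuantumFields.YangMills.Theorems.AntipodalMarkovDictionary
open Summit.QuantumFields.YangMills.Theorems.AntipodalMarkovGlue

/-! ## Name-keyed statements of the registered stubs of crux 23202 (verbatim from the v2 birth skeleton) -/
namespace __Registered

/-- = the generated glue item `SqueezedSkewness.AntipodalMarkovGlue` (stmt-QuantumFields-23391). -/
abbrev stub_markovGlue : Prop :=
  Summit.QuantumFields.YangMills.Theses.SqueezedSkewness.AntipodalMarkovGlue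

/-- The narrow twin `BoundaryResponseMixing` (verbatim from `Cruxes/NT/Lines/antipodal_markov_birth.lean` v2). -/
abbrev stub_boundaryResponseMixing : Prop :=
  ∀ (G : Type) [Group G] [TopologicalSpace G] [IsTopologicalGroup G] [CompactSpace G], IsCompactSimpleLieGroup G → letI : MeasurableSpace G := borel G; haveI : BorelSpace G := ⟨rfl⟩; ∀ (r : LatticeRep G) (a : ℝ → ℝ), (∀ β, 0 < a β) → Filter.Tendsto a Filter.atTop (nhds 0) → ∀ (ℓ τ : ℝ), 0 < ℓ → 0 < τ → ∃ (β₆ Λ₆ : ℝ), ∀ β : ℝ, β₆ ≤ β → ∀ L : ℕ, Λ₆ ≤ a β * L → ∀ (c : Fin 4 → ℤ) (b : ℕ), (b : ℝ) * a β ≤ ℓ → 1 ≤ c 0 → c 0 + (b : ℤ) + 3 ≤ (L : ℤ) → (∀ j : Fin 4, -(L : ℤ) + 2 ≤ c j ∧ c j + (b : ℤ) + 2 ≤ (L : ℤ) + 1) → c 0 ≤ (((2 * L + 1) / 4 : ℕ) : ℤ) → (((2 * L + 1) / 4 : ℕ) : ℤ) ≤ c 0 + (b : ℤ) → ∀ (z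 : Fin 4 → ℤ), 1 ≤ depth c b z → ∀ (m s : ℝ), (∀ V : LGConfig 4 G, |kerE G r β c b V (dens G r z) - m| ≤ s) → torusE G r β L (fun V => kerE G r β c b (cfgReflect V) (dens G r z) * kerE G r β c b V (dens G r z)) - torusE G r β L (fun V => kerE G r β c b (cfgReflect V) (dens G r z)) * torusE G r β L (fun V => kerE G r β c b V (dens G r z)) ≤ τ * s ^ 2

/-- Comparison: the filed mixing item implies the twin. -/
abbrev stub_twinOfMixing : Prop :=
  Summit.QuantumFields.YangMills.Theses.SqueezedSkewness.AntipodalMixing → stub_boundaryResponseMixing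

end __Registered

/-! ## The registered glue stub, by name -/

/-- **STUB `stub_markovGlue` HOLDS** — the landed `antipodalMarkovGlue_proof`. [folklore] -/
theorem stub_markovGlue : __Registered.stub_markovGlue :=
  antipodalMarkovGlue_proof

/-! ## §1 Tools: X2 at a general site of a cube, affine renormalisation of a kernel response, spatial translation -/

section Tools

variable (G : Type) [Group G] [TopologicalSpace G] [IsTopologicalGroup G] [CompactSpace G]
  [MeasurableSpace G] [BorelSpace G] (r : LatticeRep G)

/-- **Affine renormalisation of a kernel response inside the mirror covariance**: if `s ≠ 0`,
`Cov_T(K∘Θ₀, K) = s² · Cov_T(Φ∘Θ₀, Φ)` with `Φ = (K − m)/s`, `K = kerE_Q(dens z)`. [folklore] -/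
theorem mirror_cov_kerE_eq_sq_mul (β : ℝ) (c : Fin 4 → ℤ) (b L : ℕ) (z : Fin 4 → ℤ) (m s : ℝ) (hs : s ≠ 0) :
    torusE G r β L (fun V => kerE G r β c b (cfgReflect V) (dens G r z) * kerE G r β c b V (dens G r z)) -
        torusE G r β L (fun V => kerE G r β c b (cfgReflect V) (dens G r z)) *
          torusE G r β L (fun V => kerE G r β c b V (dens G r z)) =
      s ^ 2 * (torusE G r β L (fun V => (kerE G r β c b (cfgReflect V) (dens G r z) - m) / s *
            ((kerE G r β c b V (dens G r z) - m) / s)) -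
          torusE G r β L (fun V => (kerE G r β c b (cfgReflect V) (dens G r z) - m) / s) *
            torusE G r β L (fun V => (kerE G r β c b V (dens G r z) - m) / s)) := by
  haveI := r.secondCountableTopology
  obtain ⟨M, -, hM⟩ := exists_abs_dens_le G r
  set K : LGConfig 4 G → ℝ := fun η => kerE G r β c b η (dens G r z) with hK_def
  have hK : ∀ η, K η = s * ((K η - m) / s) + m := fun η => by field_simp; ring
  have hΦc : Continuous fun η => (K η - m) / s :=
    ((continuous_kerE G r β c b (continuous_dens r z) (hM z)).sub continuous_const).div_const _
  haveI := isProbabilityMeasure_wilsonMeasure (d := 4) (L := 2 * L + 1) r.ρ r.continuous β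
  have iX : Integrable (fun U : GaugeConfig 4 (2 * L + 1) G => (K (cfgReflect (torusLift (2 * L + 1) U)) - m) / s)
      (wilsonMeasure (d := 4) (L := 2 * L + 1) r.ρ β) :=
    integrable_of_continuous_compact ((hΦc.comp continuous_cfgReflect).comp (continuous_torusLift _))
  have iY : Integrable (fun U : GaugeConfig 4 (2 * L + 1) G => (K (torusLift (2 * L + 1) U) - m) / s)
      (wilsonMeasure (d := 4) (L := 2 * L + 1) r.ρ β) :=
    integrable_of_continuous_compact (hΦc.comp (continuous_torusLift _))
  have iXY : Integrable (fun U : GaugeConfig 4 (2 * L + 1) G =>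
      (K (cfgReflect (torusLift (2 * L + 1) U)) - m) / s * ((K (torusLift (2 * L + 1) U) - m) / s))
      (wilsonMeasure (d := 4) (L := 2 * L + 1) r.ρ β) :=
    integrable_of_continuous_compact (((hΦc.comp continuous_cfgReflect).comp (continuous_torusLift _)).mul
      (hΦc.comp (continuous_torusLift _)))
  unfold torusE
  have e1 : (fun U : GaugeConfig 4 (2 * L + 1) G =>
      K (cfgReflect (torusLift (2 * L + 1) U)) * K (torusLift (2 * L + 1) U)) =
      fun U => (s * ((K (cfgReflect (torusLift (2 * L + 1) U)) - m) / s) + m) *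
        (s * ((K (torusLift (2 * L + 1) U) - m) / s) + m) := by
    funext U; rw [← hK, ← hK]
  have e2 : (fun U : GaugeConfig 4 (2 * L + 1) G => K (cfgReflect (torusLift (2 * L + 1) U))) =
      fun U => s * ((K (cfgReflect (torusLift (2 * L + 1) U)) - m) / s) + m := by
    funext U; rw [← hK]
  have e3 : (fun U : GaugeConfig 4 (2 * L + 1) G => K (torusLift (2 * L + 1) U)) =
      fun U => s * ((K (torusLift (2 * L + 1) U) - m) / s) + m := by
    funext U; rw [← hK]
  rw [e1, e2, e3, cov_affine _ iX iY iXY s m]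

/-- Torus expectations are invariant under lattice translations of the observable. [folklore] -/
theorem torusE_comp_configShift' (β : ℝ) (L : ℕ) (F : LGConfig 4 G → ℝ) (v : Fin 4 → ℤ) :
    torusE G r β L (fun V => F (configShift v V)) = torusE G r β L F := by
  rw [torusE_eq_wilsonExpectation, torusE_eq_wilsonExpectation,
    show (fun U : GaugeConfig 4 (2 * L + 1) G => F (configShift v (torusLift (2 * L + 1) U))) =
      toTorusObservable (2 * L + 1) (F ∘ configShift v) from rfl,
    toTorusObservable_comp_configShift, wilsonExpectation_comp_torusConfigShift]
  rfl

/-- **Spatial translation of the one-cube response inside the mirror covariance.**  For a spatial vector `v`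
(`v 0 = 0`), moving the cube and the site by `v` does not change `Cov_T(K∘Θ₀, K)`. [folklore] -/
theorem mirror_cov_kerE_shift (β : ℝ) (c : Fin 4 → ℤ) (b L : ℕ) (z v : Fin 4 → ℤ) (hv : v 0 = 0) :
    torusE G r β L (fun V => kerE G r β (c + v) b (cfgReflect V) (dens G r (z + v)) *
          kerE G r β (c + v) b V (dens G r (z + v))) -
        torusE G r β L (fun V => kerE G r β (c + v) b (cfgReflect V) (dens G r (z + v))) *
          torusE G r β L (fun V => kerE G r β (c + v) b V (dens G r (z + v))) =
      torusE G r β L (fun V => kerE G r β c b (cfgReflect V) (dens G r z) * kerE G r β c b V (dens G r z)) -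
        torusE G r β L (fun V => kerE G r β c b (cfgReflect V) (dens G r z)) *
          torusE G r β L (fun V => kerE G r β c b V (dens G r z)) := by
  -- `K'(V) = K(θ_{-v} V)` and `Θ₀ ∘ θ_{-v} = θ_{-v} ∘ Θ₀` for spatial `v`
  have hsv : siteReflect (-v) = -v := by
    funext k
    by_cases hk : k = 0
    · subst hk; simp [hv]
    · simp [siteReflect_apply_of_ne _ hk]
  have h1 : ∀ V : LGConfig 4 G, kerE G r β (c + v) b V (dens G r (z + v)) = kerE G r β c b (configShift (-v) V) (dens G r z) := by
    intro V
    have h := kerE_dens_configShift G r v β c b (configShift (-v) V) z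
    rw [← h]
    congr 1
    funext e
    simp [configShift_apply]
  have h2 : ∀ V : LGConfig 4 G, configShift (-v) (cfgReflect V) = cfgReflect (configShift (-v) V) := by
    intro V; rw [cfgReflect_configShift, hsv]
  simp only [h1, h2]
  rw [torusE_comp_configShift' G r β L (fun W => kerE G r β c b (cfgReflect W) (dens G r z) * kerE G r β c b W (dens G r z)) (-v),
    torusE_comp_configShift' G r β L (fun W => kerE G r β c b (cfgReflect W) (dens G r z)) (-v),
    torusE_comp_configShift' G r β L (fun W => kerE G r β c b W (dens G r z)) (-v)]

end Tools

/-! ## §2 `stub_twinOfMixing`: the filed mixing item implies the narrow twin -/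

/-- **STUB `stub_twinOfMixing`**: `AntipodalMixing → BoundaryResponseMixing`.  Translate the straddling cube spatially to
`(c 0, 0⃗)` (torus translation invariance, `mirror_cov_kerE_shift`), normalise the response by `(· − m)/s`
(`mirror_cov_kerE_eq_sq_mul`), transport it to the `Fin`-torus (dictionary) and apply `AntipodalMixing` at radius `ℓ + 1`,
`b' = b + 1`: the translated response reads only links within torus sup-distance `b + 1` of `x₀ = (0⃗, ⌊T/4⌋)`. [folklore] -/
theorem stub_twinOfMixing : __Registered.stub_twinOfMixing := by
  intro hAM G _ _ _ _ hG r a ha ha0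
  letI : MeasurableSpace G := borel G
  haveI : BorelSpace G := ⟨rfl⟩
  haveI := r.secondCountableTopology
  have hMix := hAM G hG r a ha ha0
  dsimp only at hMix
  intro ℓ τ hℓ hτ
  obtain ⟨βa, hβa⟩ := eventually_le_of_tendsto ha0 (δ := 1) one_pos
  obtain ⟨β₆, Λ₆, hmix⟩ := hMix (ℓ + 1) τ (by linarith) hτ
  refine ⟨max β₆ βa, Λ₆, fun β hβ L hL c b hbℓ hc0 hcL hc hh1 hh2 z hz m s hsup => ?_⟩
  have hβ₆ : β₆ ≤ β := le_trans (le_max_left _ _) hβ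
  have hs1 : a β ≤ 1 := hβa β (le_trans (le_max_right _ _) hβ)
  -- degenerate case `s ≤ 0`: the response is constant
  rcases le_or_gt s 0 with hs0 | hs0
  · have hK : ∀ V : LGConfig 4 G, kerE G r β c b V (dens G r z) = m := fun V => by
      have := hsup V
      have h0 : |kerE G r β c b V (dens G r z) - m| = 0 := le_antisymm (this.trans hs0) (abs_nonneg _)
      rw [abs_eq_zero, sub_eq_zero] at h0
      exact h0
    simp only [hK]
    haveI := isProbabilityMeasure_wilsonMeasure (d := 4) (L := 2 * L + 1) r.ρ r.continuous β
    unfold torusE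
    simp only [integral_const, probReal_univ, smul_eq_mul, one_mul, sub_self]
    positivity
  -- spatial translation to `c' = (c 0, 0⃗)`
  set v : Fin 4 → ℤ := fun j => if j = 0 then 0 else -c j with hv_def
  have hv0 : v 0 = 0 := by simp [hv_def]
  have hcv0 : (c + v) 0 = c 0 := by simp [hv_def]
  have hcv1 : (c + v) 1 = 0 := by simp [hv_def]
  have hcv2 : (c + v) 2 = 0 := by simp [hv_def]
  have hcv3 : (c + v) 3 = 0 := by simp [hv_def]
  obtain ⟨h₀, hh₀⟩ : ∃ h₀ : ℕ, h₀ = (2 * L + 1) / 4 := ⟨_, rfl⟩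
  rw [← hh₀] at hh1 hh2
  rw [← mirror_cov_kerE_shift G r β c b L z v hv0, mirror_cov_kerE_eq_sq_mul G r β (c + v) b L (z + v) m s hs0.ne']
  -- the normalised translated response
  set Φ : LGConfig 4 G → ℝ := fun V => (kerE G r β (c + v) b V (dens G r (z + v)) - m) / s with hΦ_def
  obtain ⟨M, -, hM⟩ := exists_abs_dens_le G r
  have hKc : Continuous fun V => kerE G r β (c + v) b V (dens G r (z + v)) :=
    continuous_kerE G r β (c + v) b (continuous_dens r (z + v)) (hM (z + v))
  have hΦc : Continuous Φ := (hKc.sub continuous_const).div_const _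
  have hΦb : ∀ V, |Φ V| ≤ 1 := by
    intro V
    rw [hΦ_def]
    dsimp only
    rw [abs_div, abs_of_pos hs0, div_le_one hs0]
    have h := hsup (configShift (-v) V)
    have e1 : kerE G r β (c + v) b V (dens G r (z + v)) = kerE G r β c b (configShift (-v) V) (dens G r z) := by
      have h' := kerE_dens_configShift G r v β c b (configShift (-v) V) z
      rw [← h']
      congr 1
      funext e
      simp [configShift_apply]
    rwa [e1]
  -- locality of the translated response: window `[c + v − 1, c + v + b]`
  have hzv : 1 ≤ depth (c + v) b (z + v) := by
    have hw := window_of_depth_pos hz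
    unfold depth
    refine (Finset.le_inf'_iff _ _).2 fun j _ => ?_
    have := hw j
    rw [le_min_iff]
    simp only [Pi.add_apply]
    constructor <;> omega
  have hW : ∀ e ∈ r.curvature.supp.image (fun e => (e.1 + (z + v), e.2)), ∀ j, (c + v) j ≤ e.1 j ∧ e.1 j ≤ (c + v) j + b :=
    fun e he j => dens_supp_window_of_depth_pos G r hzv e he j
  have hcyl := isCylinder_kerE G r β (c + v) b (continuous_dens r (z + v)).measurable (isCylinder_dens G r (z + v))
  have hΦloc : ∀ U U' : LGConfig 4 G, (∀ e : Literature.MathematicalPhysics.QuantumLattice.ZdEdge 4,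
      (∀ j, (c + v) j - 1 ≤ e.1 j ∧ e.1 j ≤ (c + v) j + b) → U e = U' e) → Φ U = Φ U' := by
    intro U U' hUU'
    have : kerE G r β (c + v) b U (dens G r (z + v)) = kerE G r β (c + v) b U' (dens G r (z + v)) :=
      hcyl fun e he => hUU' e fun j => kerE_supp_window hW (Finset.mem_coe.1 he) j
    simp only [hΦ_def, this]
  -- hypotheses of `AntipodalMixing` for the transported response
  have hFm : Measurable (fun V : FinTorusSite (2 * L + 1) (2 * L + 1) (2 * L + 1) (2 * L + 1) × Fin 4 → G =>
      Φ (torusLift (2 * L + 1) (configPerm (finRotate 4) ((finTorusConfigEquivSite G (2 * L + 1)).symm V)))) :=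
    measurable_toFin hΦc.measurable
  have hFb : ∀ V : FinTorusSite (2 * L + 1) (2 * L + 1) (2 * L + 1) (2 * L + 1) × Fin 4 → G,
      |Φ (torusLift (2 * L + 1) (configPerm (finRotate 4) ((finTorusConfigEquivSite G (2 * L + 1)).symm V)))| ≤ 1 := fun V => hΦb _
  have hb1 : ((b + 1 : ℕ) : ℝ) * a β ≤ ℓ + 1 := by push_cast; nlinarith
  have hb2L : (b : ℤ) + 1 ≤ 2 * L := by have := (hc 1).1; have := (hc 1).2; omega
  have hFloc : ∀ U U' : FinTorusSite (2 * L + 1) (2 * L + 1) (2 * L + 1) (2 * L + 1) × Fin 4 → G,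
      (∀ e : FinTorusSite (2 * L + 1) (2 * L + 1) (2 * L + 1) (2 * L + 1) × Fin 4,
        (min e.1.1.val (2 * L + 1 - e.1.1.val) ≤ b + 1 ∧ min e.1.2.1.val (2 * L + 1 - e.1.2.1.val) ≤ b + 1 ∧
          min e.1.2.2.1.val (2 * L + 1 - e.1.2.2.1.val) ≤ b + 1 ∧
          min (Int.natAbs ((e.1.2.2.2.val : ℤ) - ((2 * L + 1) / 4 : ℕ)))
            (2 * L + 1 - Int.natAbs ((e.1.2.2.2.val : ℤ) - ((2 * L + 1) / 4 : ℕ))) ≤ b + 1) → U e = U' e) →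
      Φ (torusLift (2 * L + 1) (configPerm (finRotate 4) ((finTorusConfigEquivSite G (2 * L + 1)).symm U))) = Φ (torusLift (2 * L + 1) (configPerm (finRotate 4) ((finTorusConfigEquivSite G (2 * L + 1)).symm U'))) := by
    intro U U' hUU'
    refine hΦloc _ _ fun e he => ?_
    rw [torusLift_configPerm_symm_apply, torusLift_configPerm_symm_apply]
    apply hUU'
    rw [finLink_fst]
    dsimp only
    have he0 := he 0; have he1 := he 1; have he2 := he 2; have he3 := he 3
    rw [hcv0] at he0; rw [hcv1] at he1; rw [hcv2] at he2; rw [hcv3] at he3; rw [← hh₀]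
    refine ⟨min_val_intCast_le L (m := b + 1) (abs_le.2 ⟨by push_cast; omega, by push_cast; omega⟩) (by omega),
      min_val_intCast_le L (m := b + 1) (abs_le.2 ⟨by push_cast; omega, by push_cast; omega⟩) (by omega),
      min_val_intCast_le L (m := b + 1) (abs_le.2 ⟨by push_cast; omega, by push_cast; omega⟩) (by omega),
      min_natAbs_val_intCast_le L (m := b + 1) (by omega) (by omega)
        (abs_le.2 ⟨by push_cast; omega, by push_cast; omega⟩)⟩
  have hmix' := hmix β hβ₆ L hL (b + 1) hb1 _ hFm hFb hFloc
  -- back to the torus through the dictionary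
  rw [← covF_toFin_reflF (G := G) r β L Φ Φ, mul_comm τ (s ^ 2)]
  exact mul_le_mul_of_nonneg_left hmix' (sq_nonneg _)

end Summit.QuantumFields.YangMills.Theorems.AntipodalMarkovTwin

end
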